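import Summits.QuantumFields.Balaban3D.Carriers.Group
import Summits.QuantumFields.Balaban3D.Proofs.Residuals
import Summits.QuantumFields.Balaban3D.Proofs.Family
import Summits.QuantumFields.Balaban3D.Proofs.AlphaRepr
import Summits.QuantumFields.Balaban3D.Proofs.AlphaCumulant
import Summits.QuantumFields.Balaban3D.Proofs.AlphaLargeField
import Summits.QuantumFields.Balaban3D.Proofs.AlphaBound55
import Summits.QuantumFields.Balaban3D.Proofs.GroupModelLieC

/-!
# Bałaban CMP 102 (1985), d = 3 lane — `Proofs.UVStability3DInputs`: **THE END THEOREM FROM THE (α) INPUTS** (PLAN §0.5 E4, final filed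
# form `uvStability3D_of_inputs`, ruling R-MKT: the chart space PINNED to the complexified Lie algebra `𝔤ᶜ` of the group model):
# Theorem 1 (compact-coupling-window reading) ∧ Theorem 2 for the lane's CONSTRUCTED densities, from the GAP binders and the (α)
# data displays about the expansion data BY NAME, through the four adapter files; what print's argument leaves to the cited papers
# and the lane has not reduced enters as a NAMED RESIDUAL (R3D-01 `Fibre49`, R3D-02 `Fibre57Low` — seat p4), exactly as R-DISP
# prescribes

Source: T. Bałaban, *Ultraviolet stability of three-dimensional lattice pure gauge field theories*, Commun. Math. Phys. **102** (1985)
255–275 [Balaban1985UV3] ([B10]; PDF page = journal page − 254).  Lane `pub-balaban3d`, seat p3 (assembly; LEAF-LEDGER §F = the list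
below; rulings R-FL′, R-CONST, R-EPS0′, R-END″, R-DISP, R-ACT, R-32/R-32′, R-324, R-44, R-46N, R-FIBRE, R-MKT).

THE (α) INPUT LIST (per group: the primitive constants `𝔠 : Primitives.AlphaConsts L`; per lattice approximation `S`: print's external
inputs `X` (Ū of [4] with measurability + Haar compatibility, the minimizers of [7] Thm 1 / (42)), the expansion data `𝔖 k` with chart
values in `𝔤ᶜ = GroupModelLieC.lieC 𝔊` (R-32′) on `nblkOf` blocks, and the auxiliary data `𝔄 : AlphaData` ((63)-localisation binder
and G3D-08 instances, (3.24) box bounds, G3D-02 constants); on the exhibited family `S.ε₀ = ε₀(S.g)`, `ε₀(g) = (min γ₀ 1)²/g²`, `γ₀ = min(1, γ₂₈,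
γ₄₆, γ_OO, γ₇₁)`):
* per step `k < K` (`StepAlpha`): GAP binders G3D-01 `chart`, G3D-02 `hG` (+ R-ACT `hact`), G3D-04 `norm35`, G3D-05 `logZT`, G3D-06
  `far_le`, G3D-07 `𝔄.Λc k` («(63) as cited», tree `Binders.LogZLocalizedAsCited`) with `hPYZ`, G3D-08 `𝔄.N45 k` («(45) as cited» for
  the (61)-born pieces, tree `BindersNewborn.NewbornTerms45AsCited`); displays (28) `bound28`, (26) `inv26`
  (for the adjoint action of `G` on the chart space — (32) is then a THEOREM: p4 `hdet_lieC_pi` + p6 `Eq32FromInvariance`), [B1]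
  (3.24)(a)(c) `h324a`/`h324c`, (44) `h44` + degree floor `hfloor` (one row, two consumers: B15 old slice and C10), the identification
  `hPY`; data regularity `hμ`, `hboxm`, `hbox`, `hVm`, `hVB`, `hPm`/`hPb` (the interaction sum (43) measurable and bounded above —
  with the EXTERNAL-input property `hU` «U_k(·,h) measurable» they give the integrability of the (41)_k/(47)_k sides, p4
  `hint_std`/`hint47_std`, R-HINT); RESIDUALS R3D-01 `fibre49` / R3D-02 `fibre57Low` (p4 `Bound55Std.Fibre49`/`Fibre57Low`) — the
  newborn slice of (46) is NOT an input: it is seat p6's theorem `Newborn46.newborn46_std` from G3D-01/(28)/G3D-06/`hPY`, G3D-07/`hPYZ`, G3D-08;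
* per run (`RunAlpha`): the displays `hLF67` ((67) ∘ large field) and `h68` about the lifted minimizers `X.UkH` (B25).  The three
  provisos NOT IN PRINT of row B25 (LQB GAPs G-B10-02 / G-B10-10: `3r₀ + 2 ≤ 2p₀`, `8·A·K_c³/(½ log L) ≤ b₀²/(4N)`, `56 ≤ b₀²/(4N)`) are NOT
  inputs: they hold by the DEFINITION of `p₀ := 2r₀ + 1` and `b₀ := b₀(N, L, M₁, R₁, …)` (R-E2′; `Family.prov_hp/prov_hb₁/prov_hb₂`,
  `GroupModel.N_pos`).
DISCHARGED on the way (not inputs): every LQB `LeafSystem` arithmetic field, `step0`, `noInt0`, `pintSucc`, `estep62`, `starCount`,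
`ztermSucc`, `rmSucc` (Inputs/Residuals); all run slots of the leaf seats' theorems (windows from `γ₀`, the normalised units, `Rret`,
`Nblk³ ≤ |T|`, `#(blocks∖Ω) ≤ |Z|`, `ε_L ≤ ε_S`, `Rm ≥ 0`, `#Λ ≤ |Λ|`, constant signs, the E2 provisos); (32) (`hdet`); (25) for the
activities (from G3D-01 + (28)); the integrability of the (41)_k/(47)_k sides (`hint_std`); the newborn slice of (46) (`newborn46_std`).
CONCLUSION: `Theorems.Thm1AsPrintedCompact (laneT 𝔠 X 𝔖).toConstruction ∧ Theorems.Thm2AsPrintedC (laneT 𝔠 X 𝔖).toConstruction` — Theorem 1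
p. 257 (bounds (5), compact reading) and Theorem 2 p. 272 ((41) ∧ (47)) for `ρ_k = T^kρ₀` of the constructed run; and the literal
reading of Theorem 1 FAILS on the same family for any group with `d(𝔤) ≥ 1` (`not_literal_of_inputs`, G-B10-01).
HONEST FRAMING (PLAN §0): UV stability of the d = 3 lattice theory on a finite torus, as printed, MODULO its printed inputs and the
named residual rows — NOT a continuum limit, NOT infinite volume, NOT a mass gap, NOT d = 4, nothing about the Millennium problem.
No `sorry`, no new axiom; every input is a named hypothesis.
-/

noncomputable section

namespace Summit.QuantumFields.Balaban3D.Proofs.UVStability3DInputs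

open MeasureTheory Metric
open scoped BigOperators Matrix.Norms.L2Operator
open Literature.MathematicalPhysics.QuantumFieldTheory.Balaban1983to89
open Literature.MathematicalPhysics.QuantumFieldTheory.Balaban1983to89.B10
open Literature.MathematicalPhysics.QuantumFieldTheory.Balaban1983to89.B10SectAGathering
open Literature.MathematicalPhysics.QuantumFieldTheory.Balaban1983to89.B10SectCExpansion (Bound44)
open Literature.MathematicalPhysics.QuantumFieldTheory.Balaban1983to89.B10Eq24Cumulant (chiMeasure)
open Literature.MathematicalPhysics.QuantumFieldTheory.Balaban1983to89.B12TreeDecay (kappa₀ K₀)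
open Literature.MathematicalPhysics.QuantumFieldTheory.Balaban1983to89.TreeLengthTorus (tsys)
open Literature.MathematicalPhysics.QuantumFieldTheory.Balaban1985CMP102
open Literature.MathematicalPhysics.QuantumFieldTheory.Balaban1985CMP102.Setting
open Literature.MathematicalPhysics.QuantumFieldTheory.Balaban1985CMP102.Theorems
open Literature.MathematicalPhysics.QuantumFieldTheory.Balaban1985CMP102.Binders
  (ChartAnalyticityAsCited FarTermsDecayAsCited Norm35StepAsCited LogZTExtensiveAsCited LogZLocalizedAsCited GraphRep23AsCited)
open Literature.MathematicalPhysics.QuantumFieldTheory.Balaban1985CMP102.BindersNewborn (NewbornTerms45AsCited)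
open Summit.QuantumFields.Balaban3D.Carriers
open Summit.QuantumFields.Balaban3D.Proofs.ScalesArithmetic
open Summit.QuantumFields.Balaban3D.Proofs.Constants
open Summit.QuantumFields.Balaban3D.Proofs.UVStability3D
open Summit.QuantumFields.Balaban3D.Proofs.EndTheorem
open Summit.QuantumFields.Balaban3D.Proofs.Inputs
open Summit.QuantumFields.Balaban3D.Proofs.Residuals
open Summit.QuantumFields.Balaban3D.Proofs.Primitives
open Summit.QuantumFields.Balaban3D.Proofs.Family (small28 gk_le_gamma46 gk_le_gammaOO gk_le_gamma71 prov_hb₁ prov_hb₂)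
open Summit.QuantumFields.Balaban3D.Proofs.Representation33 (jet26)
open Summit.QuantumFields.Balaban3D.Proofs.Newborn46 (newborn46_std)
open Summit.QuantumFields.Balaban3D.Proofs.Bound55Std (Fibre49 Fibre57Low hint_std hint47_std)
open Summit.QuantumFields.Balaban3D.Proofs.LiftBridge (liftCfg)
open Summit.QuantumFields.Balaban3D.Proofs.Run3SmallFactors (codeZ)
open Summit.QuantumFields.Balaban3D.Proofs.GroupModelLieC (lieC adC hdet_lieC_pi)
open B7Prop1Explicit (hol plaqWord)
open B7Prop1Local (pdevOn loK plaqHiK)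
open B7Prop2Explicit (avgIter)

variable {L : ℕ}

/-! ## §0 The pinned chart space `𝔤ᶜ` and the adjoint action of `G` on a step's chart space (R-32′) -/

section Pinned

variable {G : Type} [GaugeGroup G] [MeasurableSpace G] (𝔊 : GroupModel G)

/-- **THE CHART-VALUE SPACE OF THE END THEOREM** (ruling R-32′/R-MKT): the complexified Lie algebra `𝔤ᶜ` of the group model (seat p4's
`GroupModelLieC.lieC`, a complex subspace of `ℂ^{N×N}`), with its Mathlib instances. [cite: Balaban1985UV3, (27)–(29) p.263] -/
def lieChart : ChartSpace := ⟨↥(lieC 𝔊)⟩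

/-- **«The global transformations R(U), U ∈ G» of (26)/(31) p. 264 on the chart space of step `k`**: the diagonal adjoint action on the bond
variables `𝓗 : bonds → 𝔤ᶜ` (p4's `adC`). [cite: Balaban1985UV3, (26) p.263 + (31) p.264] -/
def adjAct {P : Params} (k : ℕ) (U : G) : (PBond P k → ↥(lieC 𝔊)) →L[ℂ] (PBond P k → ↥(lieC 𝔊)) :=
  ContinuousLinearMap.pi fun b => (adC 𝔊 U).comp (ContinuousLinearMap.proj b)

/-- **«the only element invariant is 0» (p. 264 L7) IS A THEOREM for the group as printed**: no nonzero continuous linear functional on the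
step's chart space is invariant under the diagonal adjoint action — seat p4's `hdet_lieC_pi` («It is the only place we use the
semi-simplicity», p. 264 L9). [cite: Balaban1985UV3, (31)–(32) p.264] -/
theorem hdet_adjAct {P : Params} (k : ℕ) (ℓ : (PBond P k → ↥(lieC 𝔊)) →L[ℂ] ℂ)
    (hℓ : ∀ U : G, ℓ.comp (adjAct 𝔊 k U) = ℓ) : ℓ = 0 := by
  classical
  exact hdet_lieC_pi 𝔊 ℓ hℓ

end Pinned

/-! ## §1 The auxiliary expansion data and the (α) inputs -/

section Alpha

variable {S : Scales L} {G : Type} [GaugeGroup G] [MeasurableSpace G] [HaarData G] (𝔊 : GroupModel G) (𝔠 : AlphaConsts L 𝔊.N)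
  (X : ExternalInputs S G) (𝔖 : ∀ k, StepSeries S G ↥(lieC 𝔊) (nblkOf S 𝔠.lane.carrier k) k)

/-- **AUXILIARY EXPANSION DATA** the (α) displays speak about, beyond `Carriers.StepSeries`: per step `k`, the instance of the lane's GAP
binder G3D-07 «(63) as cited» (`Binders.LogZLocalizedAsCited`: the localized pieces `Ψ` and far monomials of `log Z^{(k)}(B(Λ_{k+1}), ·)`,
for the DEFINED `logZU`/`logZ1` of the pieces, the domains inside `Ω_{k+1}(h)`, the chart configurations `Bcfg`, the adjoint action) and of
G3D-08 «(45) as cited» for its (61)-born pieces (`BindersNewborn.NewbornTerms45AsCited`, constant `C45`), the box bound `Bv` of the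
effective potential of (58), the upper bound `cP` of the interaction sum (43), and the constants of G3D-02's graph bound (23) (free per
step).  DATA carrying the two binders' hypotheses BY NAME; nothing else asserted. [cite: Balaban1985UV3, (23) p.262 + (45) p.267 + (58) p.270 + (63) p.272] -/
structure AlphaData where
  /-- G3D-07 «(63) as cited» at step `k` -/
  Λc : ∀ k, LogZLocalizedAsCited (towerOf 𝔠.lane X 𝔖) k (𝔖 k).E (adjAct 𝔊 (P := S.P) k) 𝔠.ρ 𝔠.r₀ 𝔠.Cfar 𝔠.C63 𝔠.κ
    (pieces 𝔠.lane X 𝔖 k).logZU (pieces 𝔠.lane X 𝔖 k).logZ1 (𝔖 k).Bcfg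
    (fun h => Finset.univ.filter fun Y : (tsys 3 (nblkOf S 𝔠.lane.carrier k)).Dom =>
      Y.1 ⊆ ΩblkOf 𝔠.lane.carrier.M₁ (rcolOf S 𝔠.lane.carrier) (nblkOf S 𝔠.lane.carrier k) h)
  /-- G3D-08 «(45) as cited» for the (61)-born pieces of `Λc k`, at step `k` -/
  N45 : ∀ k, NewbornTerms45AsCited (towerOf 𝔠.lane X 𝔖) k (𝔖 k).E (adjAct 𝔊 (P := S.P) k) 𝔠.ρ 𝔠.r₀ 𝔠.Cfar 𝔠.C63 𝔠.κ
    (pieces 𝔠.lane X 𝔖 k).logZU (pieces 𝔠.lane X 𝔖 k).logZ1 (𝔖 k).Bcfg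
    (fun h => Finset.univ.filter fun Y : (tsys 3 (nblkOf S 𝔠.lane.carrier k)).Dom =>
      Y.1 ⊆ ΩblkOf 𝔠.lane.carrier.M₁ (rcolOf S 𝔠.lane.carrier) (nblkOf S 𝔠.lane.carrier k) h) (Λc k) 𝔠.C45
  /-- bound of the effective potential on the box, per step -/
  Bv : ℕ → ℝ
  /-- upper bound of the interaction sum `Pint k` of (43), per step -/
  cP : ℕ → ℝ
  /-- G3D-02 constants of (23), per step -/
  C₂₃ : ℕ → ℝ
  /-- G3D-02 constants of (23), per step -/
  c₂₃ : ℕ → ℝ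
  /-- G3D-02 constants of (23), per step -/
  M₂₃ : ℕ → ℝ
  /-- G3D-02 constants of (23), per step -/
  δ₀ : ℕ → ℝ

variable (𝔄 : AlphaData 𝔊 𝔠 X 𝔖)

open Classical in
/-- **THE (α) INPUTS OF STEP `k → k+1`** at the lane's pieces (LEAF-LEDGER §F; classes in the module docstring).  HYPOTHESES; nothing asserted.
[cite: Balaban1985UV3, (23)–(33) pp.262–264 + (44) p.267 + (55)–(63) pp.269–272] -/
structure StepAlpha (k : ℕ) : Prop where
  /-- the Gaussian measure of (58) is a probability measure -/
  hμ : IsProbabilityMeasure (𝔖 k).μ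
  /-- the small-field box is measurable -/
  hboxm : ∀ h, MeasurableSet ((𝔖 k).box h)
  /-- … of positive measure -/
  hbox : ∀ h, (𝔖 k).μ ((𝔖 k).box h) ≠ 0
  /-- the effective potential is a.e.-measurable -/
  hVm : ∀ h U, AEMeasurable ((𝔖 k).𝒱 h U) (𝔖 k).μ
  /-- … and bounded on the box -/
  hVB : ∀ h U, ∀ ω ∈ (𝔖 k).box h, |(𝔖 k).𝒱 h U ω| ≤ 𝔄.Bv k
  /-- G3D-01 at the (25)-rate (R-ACT) -/
  chart : ∀ Y, ChartAnalyticityAsCited ((𝔖 k).Ψ Y) 𝔠.ρ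
    (𝔠.C25 * S.gk k * Real.exp (-(𝔠.κ * (tsys 3 (nblkOf S 𝔠.lane.carrier k)).dj Y)))
  /-- (28) p. 263 -/
  bound28 : ∀ Y h U, ‖(𝔖 k).Bcfg Y h U‖ ≤ 𝔠.cB * (rFun 𝔠.r₀ (S.gk k) * S.gk k * pFun 𝔠.b₀ 𝔠.p₀ (S.gk k))
  /-- (26) in the chart space, for the adjoint action -/
  inv26 : ∀ Y (U : G), ∀ b ∈ ball (0 : (𝔖 k).E) 𝔠.ρ, adjAct 𝔊 (P := S.P) k U b ∈ ball (0 : (𝔖 k).E) 𝔠.ρ →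
    (𝔖 k).Ψ Y (adjAct 𝔊 (P := S.P) k U b) = (𝔖 k).Ψ Y b
  /-- G3D-06 -/
  far_le : FarTermsDecayAsCited (𝔖 k).far
    (fun Y => 𝔠.C25 * S.gk k * Real.exp (-(𝔠.κ * (tsys 3 (nblkOf S 𝔠.lane.carrier k)).dj Y)))
    𝔠.Cfar (S.gk k ^ 7 * (rFun 𝔠.r₀ (S.gk k) * pFun 𝔠.b₀ 𝔠.p₀ (S.gk k)) ^ 7)
  /-- identification of `PY` with the retained jet (batch 11 (a)) -/
  hPY : ∀ h U, (𝔖 k).PY h U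
    = ∑ Y ∈ (𝔖 k).loc (ΩblkOf 𝔠.lane.carrier.M₁ (rcolOf S 𝔠.lane.carrier) (nblkOf S 𝔠.lane.carrier k)) (rretOf S 𝔠.lane.carrier k) h,
        ((jet26 ((𝔖 k).Ψ Y) ((𝔖 k).Bcfg Y h U)).re - (𝔖 k).far Y h U)
  /-- identification of `PYZ` with the retained jet of the G3D-07 pieces -/
  hPYZ : ∀ h U, (𝔖 k).PYZ h U
    = ∑ Y ∈ (𝔖 k).loc (ΩblkOf 𝔠.lane.carrier.M₁ (rcolOf S 𝔠.lane.carrier) (nblkOf S 𝔠.lane.carrier k)) (rretOf S 𝔠.lane.carrier k) h,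
        ((jet26 ((𝔄.Λc k).Ψ Y) ((𝔖 k).Bcfg Y h U)).re - (𝔄.Λc k).far Y h U)
  /-- G3D-04 -/
  norm35 : Norm35StepAsCited (pieces 𝔠.lane X 𝔖 k) 𝔠.c35 𝔠.a35 𝔠.cv 𝔠.cJ35
  /-- G3D-05 -/
  logZT : LogZTExtensiveAsCited (pieces 𝔠.lane X 𝔖 k) 𝔠.cT 𝔠.aT 𝔠.cn 𝔠.cJT
  /-- R-ACT: the graph carrier's activities are the chart activities -/
  hact : ∀ h Y U, ((𝔖 k).Gt h).activities.act Y U = (𝔖 k).act h Y U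
  /-- G3D-02 -/
  hG : ∀ h, GraphRep23AsCited ((𝔖 k).Gt h) (fun U => ∑ n ∈ Finset.Icc 1 𝔠.nbar, (𝔖 k).cum h U n / (n.factorial : ℝ))
    (𝔄.C₂₃ k) (𝔄.c₂₃ k) (𝔄.M₂₃ k) (𝔄.δ₀ k)
  /-- [B1] (3.24) input (a), in the unit `(L^kg₀²)^{3+κ₀}|T₁^{(k)}|` -/
  h324a : ∀ h (U : GaugeField S.P (k + 1) G), |Real.log ((𝔖 k).μ.real ((𝔖 k).box h))| ≤
    𝔠.Ca * ((L : ℝ) ^ k * S.g0sq) ^ (3 + 𝔠.κ₀) * S.sites k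
  /-- [B1] (3.24) input (c) -/
  h324c : ∀ h U, ∀ t ∈ Set.Icc (0 : ℝ) 1, |iteratedDeriv (𝔠.nbar + 1) (ProbabilityTheory.cgf ((𝔖 k).𝒱 h U)
    (chiMeasure (𝔖 k).μ (((𝔖 k).box h).indicator fun _ => (1 : ℝ)))) t| ≤
      𝔠.Cc * ((𝔠.nbar + 1).factorial : ℝ) * ((L : ℝ) ^ k * S.g0sq) ^ (3 + 𝔠.κ₀) * S.sites k
  /-- (44) p. 267 on the previous-scale terms of the data (ONE row: consumers B15 and C10) -/
  h44 : ∀ (h : Hist S.P (k + 1)) (U : GaugeField S.P (k + 1) G), ∀ j ∈ Finset.Icc 1 k,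
    Bound44 (oldGeom S.P k j) (fun y n c => (𝔖 k).oldVal h U j y n c) 𝔠.κ₁ (𝔠.M₁ : ℝ) (ell S.P k j) (L : ℝ) 𝔠.B₃
      (S.gk k) (pFun 𝔠.b₀ 𝔠.p₀ (S.gk k)) 𝔠.C44
  /-- the degree floor «n ≥ 2» of (43) for the previous-scale terms -/
  hfloor : ∀ (h : Hist S.P (k + 1)) (U : GaugeField S.P (k + 1) G), ∀ j ∈ Finset.Icc 1 k,
    ∀ (y : Site S.P j) (n : ℕ) (c : Fin n → PBond S.P j), (𝔖 k).oldVal h U j y n c ≠ 0 → 2 ≤ n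
  /-- EXTERNAL-input property ([7] Thm 1): the composite minimizer map `U_k(·, h)` is measurable -/
  hU : ∀ h : Hist S.P k, Measurable (X.UkH k h)
  /-- data regularity: the interaction sum `Pint k h` of (43) (DEFINED from the activities) is measurable in `U` … -/
  hPm : ∀ h : Hist S.P k, Measurable ((inputOf 𝔠.lane X 𝔖).Pint k h)
  /-- … and bounded above -/
  hPb : ∀ (h : Hist S.P k) (U : GaugeField S.P k G), (inputOf 𝔠.lane X 𝔖).Pint k h U ≤ 𝔄.cP k
  /-- RESIDUAL R3D-01 (p4): «The integral (49)» ≤ (55)·(58), per new history -/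
  fibre49 : ∀ h' : Hist S.P (k + 1), Fibre49 X 𝔠.lane.carrier 𝔖 (fun _ => True) k (piecesW 𝔠.lane X 𝔖 k) h'
  /-- RESIDUAL R3D-02 (p4): the lower step bound at the trivial history -/
  fibre57Low : Fibre57Low X 𝔠.lane.carrier 𝔖 (fun _ => True) k (piecesW 𝔠.lane X 𝔖 k)

/-- **THE (α) INPUTS OF ONE LATTICE APPROXIMATION**: the step inputs for every `k < K`; the displays (67) ∘ large field and (68) about the
lifted composite minimizers `X.UkH` of [7] (B25).  (The provisos NOT IN PRINT of row B25 — `3r₀ + 2 ≤ 2p₀`, `8·A·K_c³/(½ log L) ≤ b₀²/(4N)`,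
`56 ≤ b₀²/(4N)` — are THEOREMS by the definition of `p₀`, `b₀` in `Primitives` (R-E2′, `Family.prov_hp/prov_hb₁/prov_hb₂`).)  HYPOTHESES.
[cite: Balaban1985UV3, (67)–(68) p.273 + pp.273–274] -/
structure RunAlpha : Prop where
  /-- the step inputs -/
  steps : ∀ k, k + 1 ≤ S.K → StepAlpha 𝔊 𝔠 X 𝔖 𝔄 k
  /-- (67) ∘ the large-field characteristic function of the history, on the averaged lifted minimizers -/
  hLF67 : ∀ k, k ≤ S.K → ∀ (h : Hist S.P k), Hist.Admissible 𝔠.lane.carrier.M₁ (rcolOf S 𝔠.lane.carrier) k h →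
    ∀ (U : GaugeField S.P k G), ∀ e ∈ Hist.disc h, S.gk e.1 * pFun 𝔠.lane.carrier.b₀ 𝔠.lane.carrier.p₀ (S.gk e.1) ≤
      ‖((hol (avgIter L (liftCfg 𝔊 (X.UkH k h U)) e.1) (codeZ e) (plaqWord e.2.2.1 e.2.2.2) :
          (Matrix (Fin 𝔊.N) (Fin 𝔊.N) ℂ)ˣ) : Matrix (Fin 𝔊.N) (Fin 𝔊.N) ℂ) - 1‖
  /-- (68) on the lifted minimizers -/
  h68 : ∀ k, k ≤ S.K → ∀ (h : Hist S.P k), Hist.Admissible 𝔠.lane.carrier.M₁ (rcolOf S 𝔠.lane.carrier) k h →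
    ∀ (U : GaugeField S.P k G), ∀ e ∈ Hist.disc h,
      pdevOn (loK L e.1 (codeZ e)) (plaqHiK L e.1 (codeZ e) e.2.2.1 e.2.2.2) (liftCfg 𝔊 (X.UkH k h U)) <
        𝔠.C68 * (S.gk e.1 * pFun 𝔠.lane.carrier.b₀ 𝔠.lane.carrier.p₀ (S.gk e.1)) * (((L : ℝ) ^ e.1)⁻¹) ^ 2

end Alpha

/-! ## §2 From the (α) inputs to the residual leaves -/

section Reduce

variable {S : Scales L} {G : Type} [GaugeGroup G] [MeasurableSpace G] [HaarData G] {𝔊 : GroupModel G} {𝔠 : AlphaConsts L 𝔊.N}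
  {X : ExternalInputs S G} {𝔖 : ∀ k, StepSeries S G ↥(lieC 𝔊) (nblkOf S 𝔠.lane.carrier k) k} {𝔄 : AlphaData 𝔊 𝔠 X 𝔖}
  (hS : S.ε₀ = eps0Of 𝔠.gamma0 S.g)
include hS

/-- **(25) FOR THE ACTIVITIES from G3D-01 + (28)** (R-ACT; p6 `ChartFromBound25.bound25_real_of_chart`): on the family every chart configuration
lies in the half ball. [cite: Balaban1985UV3, (25) p.262 + (28)–(29) p.263] -/
theorem bound25_act (k : ℕ) (hk : k + 1 ≤ S.K) (A : StepAlpha 𝔊 𝔠 X 𝔖 𝔄 k) (h : Hist S.P (k + 1)) :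
    Bound25Printed ⟨(tsys 3 (nblkOf S 𝔠.lane.carrier k)).Dom, GaugeField S.P (k + 1) G, (tsys 3 (nblkOf S 𝔠.lane.carrier k)).dj,
      (𝔖 k).act h⟩ (S.gk k) 𝔠.κ 𝔠.C25 :=
  ChartFromBound25.bound25_real_of_chart (T := towerOf 𝔠.lane X 𝔖) (k := k) (𝔖 k).Ψ A.chart (𝔖 k).Bcfg A.bound28
    (small28 hS k (by omega)) h

omit hS in
/-- **(25) AT THE CHART CENTRE** (the vacuum activities `Re Ψ_X(0)` of (62)): G3D-01's bound at `B = 0`. [cite: Balaban1985UV3, (25) p.262] -/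
theorem bound25_vac (k : ℕ) (A : StepAlpha 𝔊 𝔠 X 𝔖 𝔄 k) :
    Bound25Printed ⟨(tsys 3 (nblkOf S 𝔠.lane.carrier k)).Dom, GaugeField S.P (k + 1) G, (tsys 3 (nblkOf S 𝔠.lane.carrier k)).dj,
      fun Y _ => ((𝔖 k).Ψ Y 0).re⟩ (S.gk k) 𝔠.κ 𝔠.C25 := by
  intro Y _
  have hρ : 0 < 𝔠.ρ := (A.chart Y).1
  exact (Complex.abs_re_le_norm _).trans ((A.chart Y).2.2 0 (mem_closedBall_self (by positivity)))

/-- **THE RESIDUAL STEP LEAVES FROM THE (α) STEP INPUTS** on the family: C3/C4/C10 by `AlphaCumulant`, C5–C8 by `AlphaRepr` ((28) smallness and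
`γ_OO` from `γ₀`, (25) from G3D-01 + (28), (32) from `hdet_adjAct`), C1/C2 by `AlphaBound55` (from the booked residuals).
[cite: Balaban1985UV3, (55)–(61) pp.269–271 + p.272] -/
theorem stepResiduals_of_alpha (k : ℕ) (hk : k + 1 ≤ S.K) (A : StepAlpha 𝔊 𝔠 X 𝔖 𝔄 k) :
    StepResiduals 𝔠.lane X 𝔖 k := by
  haveI : RegularGaugeGroup G := groupModel_regularGaugeGroup 𝔊
  exact
  { bound55 := AlphaBound55.bound55_pieces 𝔠.lane X 𝔖 k hk
      (hint_std X 𝔠.lane.carrier 𝔖 (fun _ => True) k A.hU A.hPm (𝔄.cP k) A.hPb) A.fibre49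
    bound55Lower := AlphaBound55.bound55Lower_pieces 𝔠.lane X 𝔖 k
      (hint47_std X 𝔠.lane.carrier 𝔖 (fun _ => True) k (A.hU _) (A.hPm _) (𝔄.cP k) (A.hPb _)) A.fibre57Low
    cumulant58 := AlphaCumulant.cumulant58_pieces 𝔠.lane X 𝔖 k hk A.hμ 𝔠.kappa_ge 𝔠.C25_nonneg 𝔠.one_le_r₀ 𝔠.R₁_ge
      𝔠.Cac_nonneg rfl rfl A.hact A.hboxm A.hbox A.hVm A.hVB A.h324a A.h324c A.hG (bound25_act hS k hk A)
    cumulantLower := AlphaCumulant.cumulantLower_pieces 𝔠.lane X 𝔖 k hk A.hμ 𝔠.kappa_ge 𝔠.C25_nonneg 𝔠.one_le_r₀ 𝔠.R₁_ge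
      𝔠.Cac_nonneg rfl A.hact A.hboxm A.hbox A.hVm A.hVB A.h324a A.h324c A.hG (bound25_act hS k hk A)
    repr33_60 := AlphaRepr.repr33_60_pieces 𝔠.lane X 𝔖 k hk 𝔠.chart (by linarith [𝔠.kappa_ge]) 𝔠.C25_nonneg 𝔠.C25_le
      𝔠.κ₀_lt_half rfl A.chart A.bound28 (small28 hS k (by omega)) (adjAct 𝔊 (P := S.P) k) A.inv26
      (hdet_adjAct 𝔊 k) A.far_le A.hPY
    vacuumWhole := AlphaRepr.vacuumWhole_pieces 𝔠.lane X 𝔖 k hk 𝔠.kappa_ge 𝔠.C25_nonneg 𝔠.one_le_r₀ 𝔠.R₁_ge rfl rfl A.chart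
    decomp35_61 := AlphaRepr.decomp35_61_pieces 𝔠.lane X 𝔖 k hk 𝔠.chart rfl 𝔠.kappa_ge 𝔠.C63_nonneg 𝔠.C63_le 𝔠.one_le_r₀
      𝔠.κ₀_lt_half 𝔠.R₁_ge rfl A.bound28 (small28 hS k (by omega)) (adjAct 𝔊 (P := S.P) k) (hdet_adjAct 𝔊 k)
      (𝔄.Λc k) A.hPYZ
    norm35 := AlphaRepr.norm35_pieces 𝔠.lane X 𝔖 k 𝔠.c35_pos rfl A.norm35
    oldOutside := AlphaCumulant.oldOutside_pieces 𝔠.lane X 𝔖 k hk 𝔠.C44_nonneg 𝔠.B₃_pos.le 𝔠.κ₁_pos rfl A.h44 A.hfloor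
      (gk_le_gammaOO hS k (by omega)) }

/-- **THE RESIDUAL LEAVES OF THE RUN FROM THE (α) INPUTS** on the family: the steps by `stepResiduals_of_alpha`, B15 and B25 by `AlphaLargeField`
(thresholds `γ₄₆`, `γ₇₁` from `γ₀`; (44)/floor/newborn from the step inputs), B20/B21 by the GAP binders G3D-05/G3D-01. [cite: Balaban1985UV3, (46) p.267 + (65) p.273 + pp.273–274] -/
theorem runResiduals_of_alpha (R : RunAlpha 𝔊 𝔠 X 𝔖 𝔄) : RunResiduals 𝔠.lane X 𝔖 where
  steps k hk := stepResiduals_of_alpha hS k hk (R.steps k hk)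
  bound46 := AlphaLargeField.bound46_tower 𝔠.lane X 𝔖 𝔠.C44_nonneg 𝔠.Cnew_nonneg 𝔠.B₃_pos.le 𝔠.κ₁_pos rfl
    (fun k hk => (R.steps k hk).h44) (fun k hk => (R.steps k hk).hfloor) (fun k hk => gk_le_gamma46 hS k (by omega))
    (fun k hk => newborn46_std X 𝔠.lane.carrier 𝔖 k (by omega) (by rw [P_m, P_K]; omega) 𝔠.chart (by linarith [𝔠.kappa_ge])
      𝔠.C25_nonneg 𝔠.C63_nonneg 𝔠.b₀_pos.le 𝔠.p₀_pos (lt_of_lt_of_le one_pos 𝔠.one_le_r₀) (R.steps k hk).chart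
      (R.steps k hk).bound28 (small28 hS k (by omega)) (R.steps k hk).far_le (R.steps k hk).hPY (𝔄.Λc k) (𝔄.N45 k)
      (R.steps k hk).hPYZ)
  logZT_le k hk := AlphaRepr.logZT_le_pieces 𝔠.lane X 𝔖 k 𝔠.cT_pos rfl (R.steps k hk).logZT
  PprT_le k hk := AlphaCumulant.pprT_le_pieces 𝔠.lane X 𝔖 k hk (by linarith [𝔠.kappa_ge]) 𝔠.C25_nonneg rfl
    (bound25_vac k (R.steps k hk))
  lf := AlphaLargeField.lf_tower 𝔠.lane X 𝔖 𝔊 𝔠.R₁_nonneg (le_trans zero_le_one 𝔠.one_le_r₀)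
    (add_nonneg 𝔠.Cz_nonneg 𝔠.Cv_nonneg) 𝔠.C₅_nonneg 𝔠.C₆_nonneg 𝔠.C68_pos
    (fun j hj => gk_le_gamma71 hS j hj.le) R.hLF67 R.h68 𝔠.prov_r₀p₀ (prov_hb₁ 𝔠 𝔊.N_pos) (prov_hb₂ 𝔠 𝔊.N_pos)

end Reduce

/-! ## §3 THE END THEOREM FROM THE (α) INPUTS -/

/-- **THE LANE'S TOWER CONSTRUCTION AT THE PINNED CHART SPACE** (R-MKT): `laneT 𝔠 X 𝔖 G 𝔊 S := towerWith (stdTowerInput (X G 𝔊 S) (𝔠 G 𝔊).lane.carrier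
(𝔖 G 𝔊 S)) ⊤` with chart values in `𝔤ᶜ`. [cite: Balaban1985UV3, (38)–(43) p.266] -/
def laneT (𝔠 : ∀ (G : Type) [GaugeGroup G] [MeasurableSpace G] [HaarData G] (𝔊 : GroupModel G), AlphaConsts L 𝔊.N)
    (X : ∀ (G : Type) [GaugeGroup G] [MeasurableSpace G] [HaarData G], GroupModel G → ∀ S : Scales L, ExternalInputs S G)
    (𝔖 : ∀ (G : Type) [GaugeGroup G] [MeasurableSpace G] [HaarData G] (𝔊 : GroupModel G) (S : Scales L) (k : ℕ),
      StepSeries S G ↥(lieC 𝔊) (nblkOf S (𝔠 G 𝔊).lane.carrier k) k) : TowerConstruction L :=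
  mkT (fun G _ _ _ 𝔊 => (𝔠 G 𝔊).lane) (fun _ _ _ _ 𝔊 => lieChart 𝔊) X 𝔖

/-- **BAŁABAN CMP 102 (1985), THEOREM 1 (compact-coupling-window reading) ∧ THEOREM 2, MACHINE-CHECKED MODULO ITS PRINTED INPUTS**
(PLAN §0.5 E4, final form; R-MKT).  For every group as printed `(G, 𝔊)` let primitive constants `𝔠 G 𝔊` be given, and for every lattice
approximation `S` print's external inputs `X G 𝔊 S`, the expansion data `𝔖 G 𝔊 S k` (chart values in `𝔤ᶜ`) and the auxiliary data
`𝔄 G 𝔊 S`.  IF on the exhibited family `S.ε₀ = ε₀(S.g) = (min γ₀ 1)²/S.g²`, `γ₀ = min(1, γ₂₈, γ₄₆, γ_OO, γ₇₁)`, the (α) INPUTS `RunAlpha` hold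
— the GAP binders G3D-01/02/04/05/06/07/08, the displays (26), (28), (44), (67), (68), [B1] (3.24)(a)(c), the identifications of R-ACT /
batch 11 (a), the regularity of the expansion data and the measurability of the minimizers of [7], and the named RESIDUALS
R3D-01/R3D-02 (seat p4) — THEN **`Theorems.Thm1AsPrintedCompact (laneT 𝔠 X 𝔖).toConstruction ∧ Theorems.Thm2AsPrintedC
(laneT 𝔠 X 𝔖).toConstruction`**: the densities `ρ_k = T^kρ₀` of the CONSTRUCTED run (Wilson density (1), the renormalization
transformation (2) of [4] as a push-forward density with the one-sided version selection of R-RN, `E` by (62)/(64)) satisfy the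
bounds (5) with one O(1) per compact coupling window, independent of ε, k and the run (Theorem 1 p. 257), and the inequalities (41) ∧
(47) for `k ≤ K` (Theorem 2 p. 272), each with «ε₀ … depending on the coupling constant g only» (p. 256 L15–18) witnessed by `ε₀(g)`.
[cite: Balaban1985UV3, Thm 1 p.257 + Thm 2 p.272 + p.256 L15–18] -/
theorem uvStability3D_of_inputs
    (𝔠 : ∀ (G : Type) [GaugeGroup G] [MeasurableSpace G] [HaarData G] (𝔊 : GroupModel G), AlphaConsts L 𝔊.N)
    (X : ∀ (G : Type) [GaugeGroup G] [MeasurableSpace G] [HaarData G], GroupModel G → ∀ S : Scales L, ExternalInputs S G)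
    (𝔖 : ∀ (G : Type) [GaugeGroup G] [MeasurableSpace G] [HaarData G] (𝔊 : GroupModel G) (S : Scales L) (k : ℕ),
      StepSeries S G ↥(lieC 𝔊) (nblkOf S (𝔠 G 𝔊).lane.carrier k) k)
    (𝔄 : ∀ (G : Type) [GaugeGroup G] [MeasurableSpace G] [HaarData G] (𝔊 : GroupModel G) (S : Scales L),
      AlphaData 𝔊 (𝔠 G 𝔊) (X G 𝔊 S) (𝔖 G 𝔊 S))
    (hα : ∀ (G : Type) [GaugeGroup G] [MeasurableSpace G] [HaarData G] (𝔊 : GroupModel G) (S : Scales L),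
      S.ε₀ = eps0Of (𝔠 G 𝔊).gamma0 S.g → RunAlpha 𝔊 (𝔠 G 𝔊) (X G 𝔊 S) (𝔖 G 𝔊 S) (𝔄 G 𝔊 S)) :
    Thm1AsPrintedCompact (laneT 𝔠 X 𝔖).toConstruction ∧ Thm2AsPrintedC (laneT 𝔠 X 𝔖).toConstruction :=
  uvStability3D_of_residuals (fun G _ _ _ 𝔊 => (𝔠 G 𝔊).lane) (fun G _ _ _ 𝔊 => (𝔠 G 𝔊).gamma0)
    (fun G _ _ _ 𝔊 => (𝔠 G 𝔊).gamma0_pos) (fun _ _ _ _ 𝔊 => lieChart 𝔊) X 𝔖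
    (fun G _ _ _ 𝔊 S hS => runResiduals_of_alpha hS (hα G 𝔊 S hS))

/-- **THE LITERAL READING OF THEOREM 1 FAILS ON THE SAME CONSTRUCTED FAMILY** (G-B10-01; PLAN §0.4): for one group as printed with `d(𝔤) ≥ 1`
whose (α) inputs hold on the family, `(B10.Thm1PrintedCompact ∧ B10.Thm2Printed) ∧ ¬ B10.Thm1Printed` on `Theorems.runs (laneT 𝔠 X 𝔖).toConstruction
G 𝔊 (eps0Of γ₀)` — the vacuum-energy term `d(𝔤) log g_k |T₁^{(k)*}|` of (62) is unbounded per site over the family.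
[cite: Balaban1985UV3, Thm 1 p.257 + (62) p.271] -/
theorem not_literal_of_inputs
    (𝔠 : ∀ (G : Type) [GaugeGroup G] [MeasurableSpace G] [HaarData G] (𝔊 : GroupModel G), AlphaConsts L 𝔊.N)
    (X : ∀ (G : Type) [GaugeGroup G] [MeasurableSpace G] [HaarData G], GroupModel G → ∀ S : Scales L, ExternalInputs S G)
    (𝔖 : ∀ (G : Type) [GaugeGroup G] [MeasurableSpace G] [HaarData G] (𝔊 : GroupModel G) (S : Scales L) (k : ℕ),
      StepSeries S G ↥(lieC 𝔊) (nblkOf S (𝔠 G 𝔊).lane.carrier k) k)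
    (hL : Odd L ∧ 1 < L) (G : Type) [GaugeGroup G] [MeasurableSpace G] [HaarData G] (𝔊 : GroupModel G)
    (hdim : 1 ≤ (𝔠 G 𝔊).dimg) (𝔄 : ∀ S : Scales L, AlphaData 𝔊 (𝔠 G 𝔊) (X G 𝔊 S) (𝔖 G 𝔊 S))
    (hα : ∀ S : Scales L, S.ε₀ = eps0Of (𝔠 G 𝔊).gamma0 S.g → RunAlpha 𝔊 (𝔠 G 𝔊) (X G 𝔊 S) (𝔖 G 𝔊 S) (𝔄 S)) :
    (Thm1PrintedCompact (runs (laneT 𝔠 X 𝔖).toConstruction G 𝔊 (eps0Of (𝔠 G 𝔊).gamma0))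
        ∧ Thm2Printed (runs (laneT 𝔠 X 𝔖).toConstruction G 𝔊 (eps0Of (𝔠 G 𝔊).gamma0)))
      ∧ ¬ Thm1Printed (runs (laneT 𝔠 X 𝔖).toConstruction G 𝔊 (eps0Of (𝔠 G 𝔊).gamma0)) :=
  not_literal_of_residuals (fun G _ _ _ 𝔊 => (𝔠 G 𝔊).lane) (fun G _ _ _ 𝔊 => (𝔠 G 𝔊).gamma0) (fun _ _ _ _ 𝔊 => lieChart 𝔊)
    X 𝔖 hL G 𝔊 (𝔠 G 𝔊).gamma0_pos hdim (fun S hS => runResiduals_of_alpha hS (hα S hS))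

end Summit.QuantumFields.Balaban3D.Proofs.UVStability3DInputs

end
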